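import Literature.NumberTheory.Transcendental.MasserLemma22
import Mathlib.LinearAlgebra.Dual.Lemmas
import HarnessLib

/-!
# Complex subspaces spanned by lattice vectors are rational when `Λ` has no complex multiplication

Topic: `Literature/NumberTheory/Transcendental`. The ARITHMETIC KERNEL of the classification of the
connected algebraic subgroups of `E^γ` for an elliptic curve `E = ℂ/Λ` WITHOUT complex
multiplication (`End E = ℤ`), in the analytic form needed by the theta-model programme towards
`Literature.NumberTheory.Transcendental.philippon1986_std` (obstruction subgroups of Philippon's
zero estimate with two or more elliptic factors; the one-factor case, where nothing of the kind is
needed, is `ThetaSubgroupHull.lean` / `ThetaSubgroupClassification.lean`):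

* `NonCMLattice.exists_ratRels_of_not_hasCM` — if `Λ = ℤω₁ ⊕ ℤω₂` has no complex multiplication
  and a complex subspace `W ≤ ℂ^γ` is contained in the REAL span of its lattice vectors
  `W ∩ Λ^γ` (equivalently: `W ∩ Λ^γ` is a full lattice of the real space `W`, i.e. `W / (W ∩ Λ^γ)`
  is compact — the Lie algebra of a complex subtorus of `E^γ`), then `W` is cut out by RATIONAL
  linear relations among the coordinates: `W = {z ; ∑_b c_b z_b = 0 (c ∈ C)}` for a `ℚ`-subspace
  `C ≤ ℚ^γ` — the shape `GaGmE.Std.SubgroupDataC.C` of the tree. (With complex multiplication this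
  fails: the graph `z₂ = τ z₁` of the multiplication.)
* `NonCMLattice.ratVec_mem_of_mem` — the heart: for such `W` and `n = p ω₁ + q ω₂ ∈ W` with
  `p, q ∈ ℚ^γ`, both `p` and `q` (as complex vectors) lie in `W`. Proof: `τ n ∈ W`
  (`τ = ω₂/ω₁`) has real coordinates `(u q, p + v q)` where `τ ω₂ = u ω₁ + v ω₂`; no CM means
  `u, v` are not both rational, so some `ℚ`-linear `χ : ℝ → ℚ` kills `1` but not `(u, v)`; applying
  `χ` to the real coordinates maps the real span of the lattice vectors of `W` into `W`
  (`ratProj_mem`) and maps `τ n` to `(χ(u) ω₁ + χ(v) ω₂) · q`, whence `q ∈ W`.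
* the passage from "spanned by rational vectors" to "cut out by rational relations" is the double
  annihilator over `ℚ` (`mem_ratPart_of_forall_rel`) and a Hamel basis of `ℂ` over `ℚ`
  (`mem_of_forall_rel`).

Everything is PROVED (no named facts); [folklore] (e.g. D. Bertrand, P. Philippon, *Sous-groupes
algébriques de groupes algébriques commutatifs*, Illinois J. Math. 32 (1988), §1, for the
algebraic statement `Hom(E, E) = ℤ ⟹` algebraic subgroups of `E^γ` are defined over `ℤ`).

## References

* D. W. Masser, *Elliptic Functions and Transcendence*, LNM 437, Springer 1975, Ch. II
  (no complex multiplication: `τ` not imaginary quadratic). [Masser1975]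
* D. Bertrand, P. Philippon, *Sous-groupes algébriques de groupes algébriques commutatifs*,
  Illinois J. Math. 32 (1988), 263–280. [folklore]
-/

noncomputable section

open Complex Module

namespace Literature.NumberTheory.Transcendental

namespace NonCMLattice

variable (L : PeriodPair)

/-! ### Real coordinates in the basis `(ω₁, ω₂)` -/

/-- The real coordinate maps of `ℂ = ℝ ω₁ ⊕ ℝ ω₂`. [folklore] -/
def reCoord (i : Fin 2) : ℂ →ₗ[ℝ] ℝ := L.basis.coord i

/-- The coordinate map is the basis coordinate. [folklore] -/
theorem reCoord_apply (i : Fin 2) (z : ℂ) : reCoord L i z = L.basis.repr z i := rfl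

/-- `z = x ω₁ + y ω₂` with `(x, y)` the real coordinates. [folklore] -/
theorem reCoord_decomp (z : ℂ) :
    (reCoord L 0 z : ℂ) * L.ω₁ + (reCoord L 1 z : ℂ) * L.ω₂ = z := by
  have h := L.basis.sum_repr z
  rw [Fin.sum_univ_two, PeriodPair.basis_zero, PeriodPair.basis_one] at h
  simpa [reCoord_apply, Complex.real_smul] using h

/-- The real coordinates of `x ω₁ + y ω₂` are `(x, y)`. [folklore] -/
theorem reCoord_combo (x y : ℝ) :
    reCoord L 0 ((x : ℂ) * L.ω₁ + (y : ℂ) * L.ω₂) = x ∧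
      reCoord L 1 ((x : ℂ) * L.ω₁ + (y : ℂ) * L.ω₂) = y := by
  have h : (x : ℂ) * L.ω₁ + (y : ℂ) * L.ω₂ = x • L.basis 0 + y • L.basis 1 := by
    simp [Complex.real_smul]
  simp only [reCoord_apply, h, map_add, map_smul, Module.Basis.repr_self, smul_eq_mul,
    Finsupp.single_apply]
  simp

/-- `τ = ω₂ / ω₁`. [folklore] -/
def tau : ℂ := L.ω₂ / L.ω₁

/-- The real numbers `u = tmul 0`, `v = tmul 1` with `τ ω₂ = u ω₁ + v ω₂`. [folklore] -/
def tmul (i : Fin 2) : ℝ := reCoord L i (tau L * L.ω₂)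

/-- `ω₁ ≠ 0`. [folklore] -/
theorem ω₁_ne_zero : L.ω₁ ≠ 0 := by simpa using L.basis.ne_zero 0

/-- `τ ω₁ = ω₂`. [folklore] -/
theorem tau_mul_ω₁ : tau L * L.ω₁ = L.ω₂ := by
  rw [tau, div_mul_cancel₀ _ (ω₁_ne_zero L)]

/-- `τ ω₂ = u ω₁ + v ω₂`. [folklore] -/
theorem tau_mul_ω₂ : tau L * L.ω₂ = (tmul L 0 : ℂ) * L.ω₁ + (tmul L 1 : ℂ) * L.ω₂ :=
  (reCoord_decomp L _).symm

/-- Multiplication by `τ` in real coordinates: `τ (x ω₁ + y ω₂) = (y u) ω₁ + (x + y v) ω₂`.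
[folklore] -/
theorem tau_mul_combo (x y : ℂ) :
    tau L * (x * L.ω₁ + y * L.ω₂) = y * (tmul L 0 : ℂ) * L.ω₁ + (x + y * (tmul L 1 : ℂ)) * L.ω₂ := by
  have h1 := tau_mul_ω₁ L
  have h2 := tau_mul_ω₂ L
  linear_combination x * h1 + y * h2

/-! ### No complex multiplication: a rational functional separating `(u, v)` from `ℚ` -/

/-- If `u` and `v` are both rational then `Λ` has complex multiplication (by `d τ` for a common
denominator `d`). [folklore] -/
theorem hasCM_of_tmul_rational (a b : ℚ) (ha : (tmul L 0 : ℝ) = a) (hb : (tmul L 1 : ℝ) = b) :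
    L.HasCM := by
  -- `τ ω₂ = a ω₁ + b ω₂`; multiplier `α = d τ`, `d = a.den * b.den`
  set d : ℕ := a.den * b.den with hd
  have hdpos : 0 < d := Nat.mul_pos a.den_pos b.den_pos
  have hτ2 : tau L * L.ω₂ = (a : ℂ) * L.ω₁ + (b : ℂ) * L.ω₂ := by
    rw [tau_mul_ω₂ L, ha, hb]; push_cast; ring
  -- `d a` and `d b` are integers
  have hda : ((d : ℚ) * a) = (a.num * b.den : ℤ) := by
    rw [hd]; push_cast
    have := Rat.mul_den_eq_num a
    linear_combination (b.den : ℚ) * this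
  have hdb : ((d : ℚ) * b) = (b.num * a.den : ℤ) := by
    rw [hd]; push_cast
    have := Rat.mul_den_eq_num b
    linear_combination (a.den : ℚ) * this
  refine ⟨(d : ℂ) * tau L, fun n hn => ?_, fun l hl => ?_⟩
  · -- `d τ` is not real
    have him : (tau L).im ≠ 0 := Masser1975.im_tau_ne_zero L
    have := congrArg Complex.im hn
    simp only [Complex.mul_im, Complex.natCast_re, Complex.natCast_im, zero_mul, add_zero,
      Complex.intCast_im, mul_eq_zero, Nat.cast_eq_zero] at this
    rcases this with h | h
    · exact hdpos.ne' h
    · exact him h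
  · obtain ⟨m, n, rfl⟩ := PeriodPair.mem_lattice.mp hl
    have e1 : (d : ℂ) * tau L * L.ω₁ = (d : ℤ) * L.ω₂ := by
      rw [mul_assoc, tau_mul_ω₁]; push_cast; ring
    have e2 : (d : ℂ) * tau L * L.ω₂ = ((a.num * b.den : ℤ) : ℂ) * L.ω₁ + ((b.num * a.den : ℤ) : ℂ) * L.ω₂ := by
      rw [mul_assoc, hτ2]
      have ha' : ((d : ℚ) * a : ℚ) = ((a.num * b.den : ℤ) : ℚ) := hda
      have hb' : ((d : ℚ) * b : ℚ) = ((b.num * a.den : ℤ) : ℚ) := hdb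
      have ha'' : (d : ℂ) * (a : ℂ) = ((a.num * b.den : ℤ) : ℂ) := by exact_mod_cast congrArg (fun q : ℚ => (q : ℂ)) ha'
      have hb'' : (d : ℂ) * (b : ℂ) = ((b.num * a.den : ℤ) : ℂ) := by exact_mod_cast congrArg (fun q : ℚ => (q : ℂ)) hb'
      linear_combination L.ω₁ * ha'' + L.ω₂ * hb''
    have : (d : ℂ) * tau L * (m * L.ω₁ + n * L.ω₂) =
        ((n * (a.num * b.den) : ℤ) : ℂ) * L.ω₁ + ((m * d + n * (b.num * a.den) : ℤ) : ℂ) * L.ω₂ := by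
      push_cast at e1 e2 ⊢
      linear_combination (m : ℂ) * e1 + (n : ℂ) * e2
    rw [this]
    exact PeriodPair.mem_lattice.mpr ⟨_, _, rfl⟩

/-- **No complex multiplication gives a `ℚ`-linear functional on `ℝ` killing `1` but not both of
`u, v`.** [folklore] -/
theorem exists_ratFunctional (hCM : ¬ L.HasCM) :
    ∃ χ : ℝ →ₗ[ℚ] ℚ, χ 1 = 0 ∧ (χ (tmul L 0) ≠ 0 ∨ χ (tmul L 1) ≠ 0) := by
  set Q₁ : Submodule ℚ ℝ := Submodule.span ℚ {(1 : ℝ)} with hQ₁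
  have h1 : (1 : ℝ) ∈ Q₁ := Submodule.subset_span rfl
  -- a functional on `ℝ ⧸ ℚ` not vanishing at a non-rational class
  have key : ∀ x : ℝ, x ∉ Q₁ → ∃ χ : ℝ →ₗ[ℚ] ℚ, χ 1 = 0 ∧ χ x ≠ 0 := by
    intro x hx
    have hne : Q₁.mkQ x ≠ 0 := by rwa [Ne, Submodule.mkQ_apply, Submodule.Quotient.mk_eq_zero]
    obtain ⟨φ, hφ⟩ := not_forall.mp (mt (Module.forall_dual_apply_eq_zero_iff ℚ _).mp hne)
    refine ⟨φ.comp Q₁.mkQ, ?_, hφ⟩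
    rw [LinearMap.comp_apply, Submodule.mkQ_apply, (Submodule.Quotient.mk_eq_zero Q₁).mpr h1, map_zero]
  by_cases hu : tmul L 0 ∈ Q₁
  · by_cases hv : tmul L 1 ∈ Q₁
    · exfalso
      rw [hQ₁, Submodule.mem_span_singleton] at hu hv
      obtain ⟨a, ha⟩ := hu
      obtain ⟨b, hb⟩ := hv
      refine hCM (hasCM_of_tmul_rational L a b ?_ ?_)
      · rw [← ha, Rat.smul_one_eq_cast]
      · rw [← hb, Rat.smul_one_eq_cast]
    · obtain ⟨χ, h0, hχ⟩ := key _ hv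
      exact ⟨χ, h0, Or.inr hχ⟩
  · obtain ⟨χ, h0, hχ⟩ := key _ hu
    exact ⟨χ, h0, Or.inl hχ⟩

/-! ### The rational projection attached to a functional -/

variable {γ : Type*}

/-- Apply `χ` to the real coordinates of every entry: `z ↦ (χ(x_b) ω₁ + χ(y_b) ω₂)_b`. [folklore] -/
def ratProj (χ : ℝ →ₗ[ℚ] ℚ) : (γ → ℂ) →+ (γ → ℂ) where
  toFun z := fun b => (χ (reCoord L 0 (z b)) : ℂ) * L.ω₁ + (χ (reCoord L 1 (z b)) : ℂ) * L.ω₂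
  map_zero' := by ext b; simp
  map_add' z w := by
    ext b
    simp only [Pi.add_apply, map_add, Rat.cast_add]
    ring

/-- Entries of the rational projection. [folklore] -/
theorem ratProj_apply (χ : ℝ →ₗ[ℚ] ℚ) (z : γ → ℂ) (b : γ) :
    ratProj L χ z b = (χ (reCoord L 0 (z b)) : ℂ) * L.ω₁ + (χ (reCoord L 1 (z b)) : ℂ) * L.ω₂ := rfl

/-- On a real multiple of a vector with RATIONAL coordinates `m = p ω₁ + q ω₂` the projection is
`χ(r) · m`. [folklore] -/
theorem ratProj_smul_ratVec (χ : ℝ →ₗ[ℚ] ℚ) (r : ℝ) (m : γ → ℂ) (p q : γ → ℚ)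
    (hm : ∀ b, m b = (p b : ℂ) * L.ω₁ + (q b : ℂ) * L.ω₂) :
    ratProj L χ (r • m) = (χ r : ℂ) • m := by
  ext b
  rw [ratProj_apply, Pi.smul_apply, Pi.smul_apply, hm b, Complex.real_smul, smul_eq_mul]
  have e : (r : ℂ) * ((p b : ℂ) * L.ω₁ + (q b : ℂ) * L.ω₂) =
      ((p b • r : ℝ) : ℂ) * L.ω₁ + ((q b • r : ℝ) : ℂ) * L.ω₂ := by
    rw [Rat.smul_def, Rat.smul_def]; push_cast; ring
  rw [e, (reCoord_combo L _ _).1, (reCoord_combo L _ _).2, map_smul, map_smul, smul_eq_mul, smul_eq_mul]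
  push_cast
  ring

/-- A vector with lattice coordinates has integer, hence rational, coordinates `(p, q)`. [folklore] -/
theorem exists_ratVec_of_lattice (m : γ → ℂ) (hm : ∀ b, m b ∈ L.lattice) :
    ∃ p q : γ → ℤ, ∀ b, m b = ((p b : ℚ) : ℂ) * L.ω₁ + ((q b : ℚ) : ℂ) * L.ω₂ := by
  choose p q hpq using fun b => PeriodPair.mem_lattice.mp (hm b)
  exact ⟨p, q, fun b => by rw [← hpq b]; push_cast; ring⟩

/-- **The projection maps the real span of the lattice vectors of `W` into `W`.** [folklore] -/
theorem ratProj_mem (χ : ℝ →ₗ[ℚ] ℚ) (W : Submodule ℂ (γ → ℂ)) {x : γ → ℂ}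
    (hx : x ∈ Submodule.span ℝ {m : γ → ℂ | m ∈ W ∧ ∀ b, m b ∈ L.lattice}) :
    ratProj L χ x ∈ W := by
  obtain ⟨n, f, g, rfl⟩ := Submodule.mem_span_set'.mp hx
  rw [map_sum]
  refine Submodule.sum_mem _ fun i _ => ?_
  obtain ⟨hgW, hgl⟩ := (g i).2
  obtain ⟨p, q, hpq⟩ := exists_ratVec_of_lattice L _ hgl
  rw [ratProj_smul_ratVec L χ (f i) _ _ _ hpq]
  exact W.smul_mem _ hgW

/-! ### The heart: rational parts of vectors of `W` lie in `W` -/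

/-- **If `Λ` has no complex multiplication, `W ≤ ℂ^γ` is contained in the real span of its lattice
vectors and `n = p ω₁ + q ω₂ ∈ W` with `p, q ∈ ℚ^γ`, then `q ∈ W` and `p ∈ W`.** [folklore] -/
theorem ratVec_mem_of_mem (hCM : ¬ L.HasCM) (W : Submodule ℂ (γ → ℂ))
    (hW : (W : Set (γ → ℂ)) ⊆ Submodule.span ℝ {m : γ → ℂ | m ∈ W ∧ ∀ b, m b ∈ L.lattice})
    {n : γ → ℂ} (hn : n ∈ W) (p q : γ → ℚ) (hnpq : ∀ b, n b = (p b : ℂ) * L.ω₁ + (q b : ℂ) * L.ω₂) :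
    (fun b => (q b : ℂ)) ∈ W ∧ (fun b => (p b : ℂ)) ∈ W := by
  obtain ⟨χ, hχ1, hχ⟩ := exists_ratFunctional L hCM
  -- `τ n ∈ W`, and its projection is `(χ u ω₁ + χ v ω₂) · q`
  have hτn : tau L • n ∈ W := W.smul_mem _ hn
  have hproj := ratProj_mem L χ W (hW hτn)
  set lam : ℂ := (χ (tmul L 0) : ℂ) * L.ω₁ + (χ (tmul L 1) : ℂ) * L.ω₂ with hlam
  have hlam0 : lam ≠ 0 := by
    intro h0
    have h := LinearIndependent.pair_iff.mp L.indep (χ (tmul L 0) : ℝ) (χ (tmul L 1) : ℝ) (by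
      simp only [Complex.real_smul]
      push_cast
      rw [hlam] at h0
      exact_mod_cast h0)
    simp only [Rat.cast_eq_zero] at h
    rcases hχ with hχ | hχ
    · exact hχ h.1
    · exact hχ h.2
  have hq : ratProj L χ (tau L • n) = lam • fun b => (q b : ℂ) := by
    ext b
    rw [ratProj_apply, Pi.smul_apply, Pi.smul_apply, smul_eq_mul, smul_eq_mul, hnpq b, tau_mul_combo]
    have e : (q b : ℂ) * (tmul L 0 : ℂ) * L.ω₁ + ((p b : ℂ) + (q b : ℂ) * (tmul L 1 : ℂ)) * L.ω₂ =
        ((q b • tmul L 0 : ℝ) : ℂ) * L.ω₁ + ((p b • (1 : ℝ) + q b • tmul L 1 : ℝ) : ℂ) * L.ω₂ := by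
      simp only [Rat.smul_def, mul_one]; push_cast; ring
    rw [e, (reCoord_combo L _ _).1, (reCoord_combo L _ _).2]
    simp only [map_smul, map_add, hχ1, smul_eq_mul, hlam]
    push_cast
    ring
  have hqW : (fun b => (q b : ℂ)) ∈ W := by
    have : lam⁻¹ • ratProj L χ (tau L • n) ∈ W := W.smul_mem _ hproj
    rwa [hq, smul_smul, inv_mul_cancel₀ hlam0, one_smul] at this
  refine ⟨hqW, ?_⟩
  -- `p = ω₁⁻¹ (n - ω₂ q)`
  have hp : (fun b => (p b : ℂ)) = L.ω₁⁻¹ • (n - L.ω₂ • fun b => (q b : ℂ)) := by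
    ext b
    simp only [Pi.smul_apply, Pi.sub_apply, smul_eq_mul, hnpq b]
    field_simp [ω₁_ne_zero L]
    ring
  rw [hp]
  exact W.smul_mem _ (W.sub_mem hn (W.smul_mem _ hqW))

/-! ### From rational generators to rational relations -/

/-- The coordinatewise cast `ℚ^γ → ℂ^γ` as a `ℚ`-linear map. [folklore] -/
def castQ : (γ → ℚ) →ₗ[ℚ] (γ → ℂ) where
  toFun r := fun b => (r b : ℂ)
  map_add' r s := by ext b; simp
  map_smul' a r := by ext b; simp [Rat.smul_def]

/-- Entries of the cast. [folklore] -/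
@[simp] theorem castQ_apply (r : γ → ℚ) (b : γ) : castQ r b = (r b : ℂ) := rfl

/-- The rational vectors of `W`. [folklore] -/
def ratPart (W : Submodule ℂ (γ → ℂ)) : Submodule ℚ (γ → ℚ) := (W.restrictScalars ℚ).comap castQ

/-- Membership in the rational part. [folklore] -/
theorem mem_ratPart {W : Submodule ℂ (γ → ℂ)} {r : γ → ℚ} : r ∈ ratPart W ↔ castQ r ∈ W := Iff.rfl

variable [Fintype γ]

/-- The rational relations of `W`: `c` with `∑ c_b r_b = 0` for all rational vectors `r` of `W`.
[folklore] -/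
def ratRels (W : Submodule ℂ (γ → ℂ)) : Submodule ℚ (γ → ℚ) where
  carrier := {c | ∀ r ∈ ratPart W, ∑ b, c b * r b = 0}
  zero_mem' := fun r _ => by simp
  add_mem' := by
    intro c c' hc hc' r hr
    simp only [Pi.add_apply, add_mul, Finset.sum_add_distrib, hc r hr, hc' r hr, add_zero]
  smul_mem' := by
    intro a c hc r hr
    simp only [Pi.smul_apply, smul_eq_mul, mul_assoc, ← Finset.mul_sum, hc r hr, mul_zero]

/-- Membership in the rational relations. [folklore] -/
theorem mem_ratRels {W : Submodule ℂ (γ → ℂ)} {c : γ → ℚ} :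
    c ∈ ratRels W ↔ ∀ r ∈ ratPart W, ∑ b, c b * r b = 0 := Iff.rfl

/-- **Double annihilator over `ℚ`**: a rational vector satisfying all rational relations of `W`
is a rational vector of `W`. [folklore] -/
theorem mem_ratPart_of_forall_rel (W : Submodule ℂ (γ → ℂ)) (x : γ → ℚ)
    (hx : ∀ c ∈ ratRels W, ∑ b, c b * x b = 0) : x ∈ ratPart W := by
  classical
  rw [← Subspace.dualAnnihilator_dualCoannihilator_eq (W := ratPart W), Submodule.mem_dualCoannihilator]
  intro φ hφ
  rw [Submodule.mem_dualAnnihilator] at hφ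
  set c : γ → ℚ := fun b => φ fun j => if b = j then 1 else 0 with hc
  have hcφ : ∀ y : γ → ℚ, φ y = ∑ b, c b * y b := fun y => by
    rw [LinearMap.pi_apply_eq_sum_univ φ y]
    simp only [hc, smul_eq_mul, mul_comm]
  have hcC : c ∈ ratRels W := fun r hr => by rw [← hcφ]; exact hφ r hr
  rw [hcφ]
  exact hx c hcC

/-- **Rational vectors satisfying the rational relations, complexified**: if `W` is spanned over
`ℂ` by its rational vectors then every `z ∈ ℂ^γ` satisfying the rational relations of `W` lies in
`W` (expand the entries of `z` in a Hamel basis of `ℂ` over `ℚ`). [folklore] -/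
theorem mem_of_forall_rel (W : Submodule ℂ (γ → ℂ)) (z : γ → ℂ)
    (hz : ∀ c ∈ ratRels W, ∑ b, (c b : ℂ) * z b = 0) : z ∈ W := by
  classical
  set bC := Module.Basis.ofVectorSpace ℚ ℂ with hbC
  -- the rational coordinate vectors of `z`
  set r : Module.Basis.ofVectorSpaceIndex ℚ ℂ → γ → ℚ := fun α b => bC.repr (z b) α with hr
  have hrW : ∀ α, r α ∈ ratPart W := by
    intro α
    refine mem_ratPart_of_forall_rel W _ fun c hc => ?_
    have h' : ∑ b, c b • z b = 0 := by simpa only [Rat.smul_def] using hz c hc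
    have h := congrArg (fun w : ℂ => bC.repr w α) h'
    simpa only [map_sum, map_smul, map_zero, Finsupp.coe_finsetSum, Finsupp.coe_smul, Finset.sum_apply,
      Pi.smul_apply, Finsupp.coe_zero, Pi.zero_apply, smul_eq_mul, hr] using h
  -- `z = ∑_α (bC α) • r α` over the union of the supports
  set S : Finset (Module.Basis.ofVectorSpaceIndex ℚ ℂ) :=
    Finset.univ.biUnion fun b => (bC.repr (z b)).support with hS
  have hzsum : z = ∑ α ∈ S, (bC α) • castQ (r α) := by
    ext b
    have hsupp : (bC.repr (z b)).support ⊆ S := Finset.subset_biUnion_of_mem (fun b => (bC.repr (z b)).support) (Finset.mem_univ b)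
    have h := bC.linearCombination_repr (z b)
    rw [Finsupp.linearCombination_apply,
      Finsupp.sum_of_support_subset _ hsupp (fun i a => a • bC i) (fun α _ => zero_smul ℚ _)] at h
    rw [Finset.sum_apply]
    simp only [Pi.smul_apply, castQ_apply, smul_eq_mul, hr]
    refine h.symm.trans (Finset.sum_congr rfl fun α _ => ?_)
    rw [Rat.smul_def, mul_comm]
  rw [hzsum]
  exact W.sum_mem fun α _ => W.smul_mem _ ((mem_ratPart).mp (hrW α))

/-! ### The theorem -/

/-- **Complex subspaces spanned by lattice vectors are rational (no complex multiplication).**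
If `Λ` has no complex multiplication and `W ≤ ℂ^γ` is contained in the real span of
`W ∩ Λ^γ`, then `W = {z ; ∑_b c_b z_b = 0 for all c ∈ C}` for the `ℚ`-subspace `C = ratRels W` of
`ℚ^γ`. [folklore] -/
theorem mem_iff_forall_ratRels (hCM : ¬ L.HasCM) (W : Submodule ℂ (γ → ℂ))
    (hW : (W : Set (γ → ℂ)) ⊆ Submodule.span ℝ {m : γ → ℂ | m ∈ W ∧ ∀ b, m b ∈ L.lattice})
    (z : γ → ℂ) : z ∈ W ↔ ∀ c ∈ ratRels W, ∑ b, (c b : ℂ) * z b = 0 := by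
  refine ⟨fun hzW c hc => ?_, mem_of_forall_rel W z⟩
  -- `W ⊆ span_ℂ (rational vectors of W)`, on which the relation `c` vanishes
  have hgen : (W : Set (γ → ℂ)) ⊆ Submodule.span ℂ (castQ '' (ratPart W : Set (γ → ℚ))) := by
    intro w hw
    have hle : Submodule.span ℝ {m : γ → ℂ | m ∈ W ∧ ∀ b, m b ∈ L.lattice} ≤
        (Submodule.span ℂ (castQ '' (ratPart W : Set (γ → ℚ)))).restrictScalars ℝ := by
      refine Submodule.span_le.mpr ?_
      rintro m ⟨hmW, hml⟩
      obtain ⟨p, q, hpq⟩ := exists_ratVec_of_lattice L m hml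
      obtain ⟨hqW, hpW⟩ := ratVec_mem_of_mem L hCM W hW hmW _ _ hpq
      have hm : m = L.ω₁ • castQ (fun b => (p b : ℚ)) + L.ω₂ • castQ (fun b => (q b : ℚ)) := by
        ext b
        simp only [Pi.add_apply, Pi.smul_apply, castQ_apply, smul_eq_mul, hpq b]
        ring
      rw [SetLike.mem_coe, Submodule.restrictScalars_mem, hm]
      refine Submodule.add_mem _ (Submodule.smul_mem _ _ (Submodule.subset_span ⟨_, hpW, rfl⟩))
        (Submodule.smul_mem _ _ (Submodule.subset_span ⟨_, hqW, rfl⟩))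
    exact hle (hW hw)
  have key : ∀ w ∈ Submodule.span ℂ (castQ '' (ratPart W : Set (γ → ℚ))), ∑ b, (c b : ℂ) * w b = 0 := by
    intro w hw
    induction hw using Submodule.span_induction with
    | mem x hx =>
      obtain ⟨r, hr, rfl⟩ := hx
      have := (mem_ratRels).mp hc r hr
      simpa [castQ_apply] using congrArg (fun t : ℚ => (t : ℂ)) this
    | zero => simp
    | add x y _ _ hx hy => simp only [Pi.add_apply, mul_add, Finset.sum_add_distrib, hx, hy, add_zero]
    | smul a x _ hx =>
      simp only [Pi.smul_apply, smul_eq_mul, mul_left_comm _ a, ← Finset.mul_sum, hx, mul_zero]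
  exact key z (hgen hzW)

/-- **The rational relations of a complex subspace spanned by lattice vectors, no complex
multiplication** — existence form, the shape `GaGmE.Std.SubgroupDataC.C` of the tree. [folklore] -/
theorem exists_ratRels_of_not_hasCM (hCM : ¬ L.HasCM) (W : Submodule ℂ (γ → ℂ))
    (hW : (W : Set (γ → ℂ)) ⊆ Submodule.span ℝ {m : γ → ℂ | m ∈ W ∧ ∀ b, m b ∈ L.lattice}) :
    ∃ C : Submodule ℚ (γ → ℚ), ∀ z : γ → ℂ, z ∈ W ↔ ∀ c ∈ C, ∑ b, (c b : ℂ) * z b = 0 :=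
  ⟨ratRels W, mem_iff_forall_ratRels L hCM W hW⟩

end NonCMLattice

end Literature.NumberTheory.Transcendental

end
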